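import Summits.BirchSwinnertonDyer.BirchSwinnertonDyer.Theorems.UniversalToricDescentDefectTransportOfSigmaCongruence
import HarnessLib

/-!
# Route UniversalToricDescent, crux ♭T≤ `DefectTransportModThreePT` (stmt-BirchSwinnertonDyer-23042), research
# residue A `SigmaCongruenceAtThree` (stmt-BirchSwinnertonDyer-27120) — the CONVERSE of the norm-profile
# extraction: equal norm profiles in `R₀⟦T⟧` ⇒ congruent `mod 𝔪_{R₀}` up to a unit, so A's conclusion
# «`∃ e u, IsUnit u ∧ … ∧ ∀ i, ‖[Tⁱ](𝓛·Π_e − u·𝓛′·Π′_e)‖ < 1`» is EXACTLY the Greenberg–Vatsal invariant pair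
# «`μ(𝓛) = 0` and `λ(𝓛) + Σ_v d_v(E)·3^{v(e_v)} = λ(𝓛′) + Σ_v d_v(E′)·3^{v(e_v)}`» given `μ(𝓛′) = 0`

Width prover bsd-wall-utd-p1-w2 g5 (`--supports stmt-BirchSwinnertonDyer-23042`, helper; the by-product flagged by
the ideation seat utd-idea g35, `Sketch-utd-idea-g35.lean` typed the two Props `CongruenceOfEqualProfiles` /
`SigmaCongruenceIffEqualProfile` without proof). Pure algebra in `R₀⟦T⟧ = UnrSeries p` (`R₀ = unrIntegers p ⊂ ℂ_p`)
in the route's NORM-PROFILE currency «`‖[T^i]X‖ < 1 (i < n)`, `‖[T^n]X‖ = 1`» (= `μ(X) = 0 ∧ λ(X) = n`); no elliptic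
curve enters §1–§2.

* §1 `exists_isUnit_forall_norm_coeff_sub_lt_of_normProfile` — `X`, `Y` with the SAME profile `n` ⟹ there is a
  unit `u` of `R₀⟦T⟧` with `‖[Tⁱ](X − u·Y)‖ < 1` for every `i`: write `X = Tⁿ·X₁ + X₀`, `Y = Tⁿ·Y₁ + Y₀` with
  every coefficient of `X₀, Y₀` of norm `< 1` and `X₁(0) = X_n`, `Y₁(0) = Y_n` units of `R₀`
  (`unrIntegers.isUnit_iff_norm_eq_one`), `u := X₁·Y₁⁻¹`; then `X − u·Y = X₀ − u·Y₀`.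
* §2 `exists_isUnit_sigmaCongruence_iff_normProfile` — for `Y` of profile `m`:
  «`∃ u` unit, `X ≡ u·Y (mod 𝔪)`» ⟺ «`X` has profile `m`» (→ is the landed
  `normProfile_of_forall_norm_sub_lt` ∘ `normProfile_mul_of_isUnit`).
* §3 the converses, in the EXACT data of `UniversalToricDescentDefectTransport.exists_normProfile_of_sigmaCongruence` /
  `analyticIdentity_of_sigmaCongruence` (utd-p1 g12, p616991): profiles `m, m′` of `L, L′` with
  `m + Σ_v d_v(E)·p^{v(e_v)} = m′ + Σ_v d_v(E′)·p^{v(e_v)}` (resp. with `Σ_v 3^{c_v}s_v`) ⟹ a unit `u` with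
  `L·∏_{v∈T}𝒫_v(E) ≡ u·L′·∏_{v∈T}𝒫_v(E′) (mod 𝔪_{R₀})` coefficientwise — so the research statement A is the
  invariant identity and nothing more (the unit `u` carries no information).
* Sequel `UniversalToricDescentSigmaCongruenceAtThreeIffInvariantPair`: the route decl `SigmaCongruenceAtThree` BY NAME
  ⟺ its invariant-pair form (restatement certificate for the planner).

THEOREMS ONLY; no definition, no named fact, no `sorry`. Closes nothing by itself; BSD is not advanced by this file.
References: [Washington1997] §7.1 (μ, λ, distinguished polynomials and units of `𝒪⟦T⟧`);
[GreenbergVatsal2000] Thm. (1.5), §1 display (9); [LeiMullerXia2023] Lemma 3.5, Cor. 3.8.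
-/

set_option autoImplicit false
-- `…BirchSwinnertonDyer.BirchSwinnertonDyer.Theorems…` is the problem's mandated namespace (D-0017).
set_option linter.dupNamespace false

noncomputable section

open scoped Classical

/-! ### §1 Equal norm profiles ⇒ congruent mod `𝔪_{R₀}` up to a unit -/

namespace Summit.BirchSwinnertonDyer.BirchSwinnertonDyer.Theorems.UniversalToricDescentNormProfile

open Literature.NumberTheory.EllipticCurves PowerSeries

variable {p : ℕ} [Fact p.Prime]

/-- If EVERY coefficient of `X ∈ R₀⟦T⟧` has norm `< 1` (`X ∈ 𝔪⟦T⟧`), then so has every coefficient of `u·X`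
for any `u ∈ R₀⟦T⟧` (`𝔪⟦T⟧` is an ideal; ultrametric inequality on the Cauchy product). [folklore] -/
theorem forall_norm_coeff_mul_lt_one (u : UnrSeries p) {X : UnrSeries p}
    (hX : ∀ i, ‖((PowerSeries.coeff i X : unrIntegers p) : ℂ_[p])‖ < 1) (i : ℕ) :
    ‖((PowerSeries.coeff i (u * X) : unrIntegers p) : ℂ_[p])‖ < 1 :=
  norm_coeff_mul_lt_one_of_lt u (n := i + 1) (fun j _ ↦ hX j) i (Nat.lt_succ_self i)

/-- Coefficientwise congruences `mod 𝔪_{R₀}` subtract: if all coefficients of `A` and of `B` have norm `< 1`,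
so have all coefficients of `A − B`. [folklore] -/
theorem forall_norm_coeff_sub_lt_one {A B : UnrSeries p}
    (hA : ∀ i, ‖((PowerSeries.coeff i A : unrIntegers p) : ℂ_[p])‖ < 1)
    (hB : ∀ i, ‖((PowerSeries.coeff i B : unrIntegers p) : ℂ_[p])‖ < 1) (i : ℕ) :
    ‖((PowerSeries.coeff i (A - B) : unrIntegers p) : ℂ_[p])‖ < 1 := by
  rw [map_sub, AddSubgroupClass.coe_sub, sub_eq_add_neg]
  refine lt_of_le_of_lt (IsUltrametricDist.norm_add_le_max _ _) (max_lt (hA i) ?_)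
  rw [norm_neg]
  exact hB i

/-- **Splitting off the tail at the first unit coefficient.** For `X ∈ R₀⟦T⟧` with norm profile `n`
(`‖[T^i]X‖ < 1` for `i < n`, `‖[T^n]X‖ = 1`) put `X₁ := Σ_i [T^{n+i}]X · T^i`; then `X₁` is a UNIT of `R₀⟦T⟧`
(its constant term `[T^n]X` has norm `1`, `unrIntegers.isUnit_iff_norm_eq_one`) and every coefficient of
`X − Tⁿ·X₁` has norm `< 1`. [cite: Washington1997, §7.1 (proof of the p-adic Weierstrass preparation theorem)] -/
theorem isUnit_shift_and_forall_norm_coeff_sub_lt_of_normProfile {X : UnrSeries p} {n : ℕ}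
    (hX : (∀ i < n, ‖((PowerSeries.coeff i X : unrIntegers p) : ℂ_[p])‖ < 1) ∧
      ‖((PowerSeries.coeff n X : unrIntegers p) : ℂ_[p])‖ = 1) :
    IsUnit (PowerSeries.mk fun i ↦ PowerSeries.coeff (n + i) X) ∧
      ∀ i, ‖((PowerSeries.coeff i
          (X - PowerSeries.X ^ n * PowerSeries.mk fun i ↦ PowerSeries.coeff (n + i) X) :
            unrIntegers p) : ℂ_[p])‖ < 1 := by
  refine ⟨?_, fun i ↦ ?_⟩
  · rw [PowerSeries.isUnit_iff_constantCoeff, ← PowerSeries.coeff_zero_eq_constantCoeff_apply,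
      PowerSeries.coeff_mk, Nat.add_zero]
    exact (unrIntegers.isUnit_iff_norm_eq_one _).mpr hX.2
  · rw [map_sub, PowerSeries.coeff_X_pow_mul']
    by_cases hni : n ≤ i
    · rw [if_pos hni, PowerSeries.coeff_mk, Nat.add_sub_cancel' hni, sub_self, ZeroMemClass.coe_zero,
        norm_zero]
      exact zero_lt_one
    · rw [if_neg hni, sub_zero]
      exact hX.1 i (Nat.lt_of_not_le hni)

/-- **Equal norm profiles ⇒ congruent `mod 𝔪_{R₀}` up to a unit** (the converse of
`normProfile_of_forall_norm_sub_lt`): if `X, Y ∈ R₀⟦T⟧` have the SAME norm profile `n` (`μ = 0`, `λ = n` for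
both), there is a unit `u` of `R₀⟦T⟧` with `‖[T^i](X − u·Y)‖ < 1` for every `i`. Proof: `X = Tⁿ·X₁ + X₀`,
`Y = Tⁿ·Y₁ + Y₀` as in `isUnit_shift_and_forall_norm_coeff_sub_lt_of_normProfile`, `u := X₁·Y₁⁻¹`, and
`X − u·Y = X₀ − u·Y₀ ∈ 𝔪⟦T⟧`. (Over the residue field: both reduce to `T̄ⁿ·(unit)`.)
[cite: Washington1997, §7.1] -/
theorem exists_isUnit_forall_norm_coeff_sub_lt_of_normProfile {X Y : UnrSeries p} {n : ℕ}
    (hX : (∀ i < n, ‖((PowerSeries.coeff i X : unrIntegers p) : ℂ_[p])‖ < 1) ∧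
      ‖((PowerSeries.coeff n X : unrIntegers p) : ℂ_[p])‖ = 1)
    (hY : (∀ i < n, ‖((PowerSeries.coeff i Y : unrIntegers p) : ℂ_[p])‖ < 1) ∧
      ‖((PowerSeries.coeff n Y : unrIntegers p) : ℂ_[p])‖ = 1) :
    ∃ u : UnrSeries p, IsUnit u ∧
      ∀ i, ‖((PowerSeries.coeff i (X - u * Y) : unrIntegers p) : ℂ_[p])‖ < 1 := by
  obtain ⟨hX₁, hX₀⟩ := isUnit_shift_and_forall_norm_coeff_sub_lt_of_normProfile hX
  obtain ⟨hY₁, hY₀⟩ := isUnit_shift_and_forall_norm_coeff_sub_lt_of_normProfile hY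
  set X₁ : UnrSeries p := PowerSeries.mk fun i ↦ PowerSeries.coeff (n + i) X with hX₁def
  set Y₁ : UnrSeries p := PowerSeries.mk fun i ↦ PowerSeries.coeff (n + i) Y with hY₁def
  obtain ⟨v, hv⟩ := hY₁
  -- `u := X₁ · Y₁⁻¹`
  set w : UnrSeries p := ((v⁻¹ : (UnrSeries p)ˣ) : UnrSeries p) with hwdef
  have hwv : w * Y₁ = 1 := by rw [← hv, hwdef, Units.inv_mul]
  refine ⟨X₁ * w, hX₁.mul (v⁻¹).isUnit, fun i ↦ ?_⟩
  have hkey : X - X₁ * w * Y =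
      (X - PowerSeries.X ^ n * X₁) - X₁ * w * (Y - PowerSeries.X ^ n * Y₁) := by
    linear_combination (-(PowerSeries.X ^ n * X₁)) * hwv
  rw [hkey]
  exact forall_norm_coeff_sub_lt_one hX₀ (forall_norm_coeff_mul_lt_one _ hY₀) i

/-! ### §2 The Σ-congruence shape ⟺ the norm profile -/

/-- **«`X ≡ u·Y (mod 𝔪_{R₀})` for a unit `u`» ⟺ «`X` has the norm profile of `Y`».** For `Y ∈ R₀⟦T⟧` with
profile `m` (`μ(Y) = 0`, `λ(Y) = m`): there is a unit `u` of `R₀⟦T⟧` with `‖[T^i](X − u·Y)‖ < 1` for all `i`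
iff `X` has profile `m`. (→: `u·Y` has profile `m` by `normProfile_mul_of_isUnit`, and a congruence `mod 𝔪`
preserves the profile, `normProfile_of_forall_norm_sub_lt`; ←: §1.) This is the shape of the conclusion of the
research statement `SigmaCongruenceAtThree` (stmt-27120) with `X = 𝓛·Π_e(E)`, `Y = 𝓛′·Π_e(E′)`.
[cite: Washington1997, §7.1] [cite: GreenbergVatsal2000, Thm. (1.5)] -/
theorem exists_isUnit_sigmaCongruence_iff_normProfile {X Y : UnrSeries p} {m : ℕ}
    (hY : (∀ i < m, ‖((PowerSeries.coeff i Y : unrIntegers p) : ℂ_[p])‖ < 1) ∧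
      ‖((PowerSeries.coeff m Y : unrIntegers p) : ℂ_[p])‖ = 1) :
    (∃ u : UnrSeries p, IsUnit u ∧
        ∀ i, ‖((PowerSeries.coeff i (X - u * Y) : unrIntegers p) : ℂ_[p])‖ < 1) ↔
      ((∀ i < m, ‖((PowerSeries.coeff i X : unrIntegers p) : ℂ_[p])‖ < 1) ∧
        ‖((PowerSeries.coeff m X : unrIntegers p) : ℂ_[p])‖ = 1) := by
  constructor
  · rintro ⟨u, hu, h⟩
    exact normProfile_of_forall_norm_sub_lt h (normProfile_mul_of_isUnit hu hY)
  · intro hX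
    exact exists_isUnit_forall_norm_coeff_sub_lt_of_normProfile hX hY

end Summit.BirchSwinnertonDyer.BirchSwinnertonDyer.Theorems.UniversalToricDescentNormProfile

/-! ### §3 The converses in the data of `exists_normProfile_of_sigmaCongruence` / `analyticIdentity_of_sigmaCongruence` -/

namespace Summit.BirchSwinnertonDyer.BirchSwinnertonDyer.Theorems.UniversalToricDescentDefectTransport

open Function Field NumberField IsDedekindDomain WeierstrassCurve Polynomial
open Literature.NumberTheory.GaloisRepresentations Literature.NumberTheory.EllipticCurves
  Literature.NumberTheory.EllipticCurves.GreenbergSelmer Literature.NumberTheory.GaloisCohomology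
  Literature.NumberTheory.EllipticCurves.GreenbergVatsal2000
  Literature.NumberTheory.EllipticCurves.IwasawaAlgebra Literature.NumberTheory.EllipticCurves.Rank1Residual
  Summit.BirchSwinnertonDyer.Rank1Residual Summit.BirchSwinnertonDyer.Rank1Residual.X11b
  Summit.BirchSwinnertonDyer.Rank1Residual.X11b.Coinv Summit.BirchSwinnertonDyer.Rank1Residual.X11b.AcSelmer
  Summit.BirchSwinnertonDyer.Rank1Residual.X11b.LocBridge Summit.BirchSwinnertonDyer.Rank1Residual.Iwasawa
  Summit.BirchSwinnertonDyer.BirchSwinnertonDyer.Theorems.UniversalToricDescentNormProfile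
  Summit.BirchSwinnertonDyer.BirchSwinnertonDyer.Theorems.UniversalToricDescentAcEulerFactor
  Summit.BirchSwinnertonDyer.Rank1Residual.X2.EulerFactorAlgebra

/-- **The Σ-congruence FROM the profiles and the Σ-depleted `λ`-identity** (converse of
`exists_normProfile_of_sigmaCongruence`). For a number field `K`, Weierstrass curves `E, E′` over `K`, a finite
set `T` of places `v ∤ p`, exponents `e_v ≠ 0`, and `L, L′ ∈ R₀⟦T⟧` with norm profiles `m, m′` satisfying
`m + Σ_v d_v(E)·p^{v_p(e_v)} = m′ + Σ_v d_v(E′)·p^{v_p(e_v)}`: there is a unit `u` of `R₀⟦T⟧` with every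
coefficient of `L·∏_{v∈T}𝒫_v(E) − u·L′·∏_{v∈T}𝒫_v(E′)` of norm `< 1` (`𝒫_v(·) = P_v(q_v⁻¹(1+T)^{e_v})` read in
`R₀⟦T⟧`): both Σ-depleted series have the common profile `m + Σ_v d_v(E)·p^{v(e_v)}`
(`order_map_toZMod_prod_aeval_localPolynomialAt`, `normProfile_mul`), and §1 applies. So the congruence
«Greenberg–Vatsal (1.5)» carries exactly the information «equal `μ = 0` and Σ-depleted `λ`».
[cite: GreenbergVatsal2000, Thm. (1.5) and §1 display (9)] [cite: LeiMullerXia2023, Lemma 3.5 and Cor. 3.8] -/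
theorem exists_isUnit_sigmaCongruence_of_normProfile {K : Type} [Field K] [NumberField K]
    (E E' : WeierstrassCurve K) {p : ℕ} [Fact p.Prime] (T : Finset (HeightOneSpectrum (𝓞 K)))
    (hT : ∀ v ∈ T, ((p : ℕ) : 𝓞 K) ∉ v.asIdeal) (e : HeightOneSpectrum (𝓞 K) → ℤ_[p])
    (he : ∀ v ∈ T, e v ≠ 0) {L L' : UnrSeries p} {m m' : ℕ}
    (hm : (∀ i < m, ‖((PowerSeries.coeff i L : unrIntegers p) : ℂ_[p])‖ < 1) ∧
      ‖((PowerSeries.coeff m L : unrIntegers p) : ℂ_[p])‖ = 1)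
    (hm' : (∀ i < m', ‖((PowerSeries.coeff i L' : unrIntegers p) : ℂ_[p])‖ < 1) ∧
      ‖((PowerSeries.coeff m' L' : unrIntegers p) : ℂ_[p])‖ = 1)
    (hsum : m + ∑ v ∈ T, (eulerFactorModP E p v).rootMultiplicity
            (((Nat.card (IsLocalRing.ResidueField (v.adicCompletionIntegers K)) : ℕ) : ZMod p)⁻¹) *
          p ^ (e v).valuation =
        m' + ∑ v ∈ T, (eulerFactorModP E' p v).rootMultiplicity
            (((Nat.card (IsLocalRing.ResidueField (v.adicCompletionIntegers K)) : ℕ) : ZMod p)⁻¹) *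
          p ^ (e v).valuation) :
    ∃ u : UnrSeries p, IsUnit u ∧ ∀ i : ℕ, ‖((PowerSeries.coeff i
        (L * PowerSeries.map (Halves.toUnr p) (∏ v ∈ T, (Polynomial.aeval
            (PowerSeries.C ((Nat.card (IsLocalRing.ResidueField (v.adicCompletionIntegers K)) : ℤ_[p]).inv) *
              PowerSeries.binomialSeries ℤ_[p] (e v)) (E.localPolynomialAt v) : IwasawaAlgebra p)) -
          u * (L' * PowerSeries.map (Halves.toUnr p) (∏ v ∈ T, (Polynomial.aeval
            (PowerSeries.C ((Nat.card (IsLocalRing.ResidueField (v.adicCompletionIntegers K)) : ℤ_[p]).inv) *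
              PowerSeries.binomialSeries ℤ_[p] (e v)) (E'.localPolynomialAt v) : IwasawaAlgebra p)))) :
        unrIntegers p) : ℂ_[p])‖ < 1 := by
  -- the Euler products have norm profiles `D = Σ d_v(E) p^{v(e_v)}` and `D′`
  obtain ⟨-, hordE⟩ := order_map_toZMod_prod_aeval_localPolynomialAt E T hT e he
  obtain ⟨-, hordE'⟩ := order_map_toZMod_prod_aeval_localPolynomialAt E' T hT e he
  have hPE := normProfile_map_toUnr_of_order_eq _ hordE
  have hPE' := normProfile_map_toUnr_of_order_eq _ hordE'
  -- so `L·Π(E)` has profile `m + D` and `L′·Π(E′)` has profile `m′ + D′ = m + D`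
  have h1 := normProfile_mul hm hPE
  have h2 := normProfile_mul hm' hPE'
  rw [← hsum] at h2
  exact (exists_isUnit_sigmaCongruence_iff_normProfile h2).mpr h1

/-- **The Σ-congruence FROM the analytic identity of ♭T** (converse of `analyticIdentity_of_sigmaCongruence`, in
the data of `defectTransport_frames_of_analytic`'s hypothesis `hAn`): for `E = W_K`, `E′ = W′_K`, a
`ℤ₃`-extension `κ`, a finite set `T` of places `v ∤ 3` with exact indices `c_v` and local exponents
`#H¹(kerD κ v, ·[3^∞])[3] = 3^{s_v}, 3^{s′_v}`, exponents `e_v ≠ 0` with `v_3(e_v) = c_v`, and profiles `m, m′` of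
`L, L′` with `m + Σ_v 3^{c_v} s_v = m′ + Σ_v 3^{c_v} s′_v`: there is a unit `u` of `R₀⟦T⟧` with
`L·∏𝒫_v(E) ≡ u·L′·∏𝒫_v(E′) (mod 𝔪_{R₀})` coefficientwise (`λ(𝒫_v) = 3^{c_v}·d_v` and `d_v = s_v`,
`natCard_pTorsion_subgroupH1_kerD_eq_pow_rootMultiplicity`). Together with `analyticIdentity_of_sigmaCongruence`:
the research statement `SigmaCongruenceAtThree` (stmt-27120) is, frame by frame, EQUIVALENT to
«`μ(𝓛) = 0` ∧ the λ-identity» given `μ(𝓛′) = 0`.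
[cite: GreenbergVatsal2000, Thm. (1.5), §1 display (9), §2 Prop. (2.4)] [cite: LeiMullerXia2023, Cor. 3.8] -/
theorem exists_isUnit_sigmaCongruence_of_analyticIdentity (W W' : WeierstrassCurve ℚ) [W.IsElliptic]
    [W'.IsElliptic] (K : Type) [Field K] [NumberField K] (κ : ZpExtension K 3)
    (T : Finset (HeightOneSpectrum (𝓞 K))) (c s s' : HeightOneSpectrum (𝓞 K) → ℕ)
    (hT : ∀ v ∈ T, ((3 : ℕ) : 𝓞 K) ∉ v.asIdeal)
    (hdata : ∀ v ∈ T,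
      (∃ d₀ : decomp (K := K) v, (κ (d₀ : absoluteGaloisGroup K)).toAdd = (3 : ℤ_[3]) ^ c v) ∧
        (∀ d : decomp (K := K) v, (3 : ℤ_[3]) ^ c v ∣ (κ (d : absoluteGaloisGroup K)).toAdd) ∧
        Nat.card {f : subgroupH1 (kerD κ v) ((W.baseChange K).geomPrimaryTorsion 3) // 3 • f = 0} =
          3 ^ s v ∧
        Nat.card {f : subgroupH1 (kerD κ v) ((W'.baseChange K).geomPrimaryTorsion 3) // 3 • f = 0} =
          3 ^ s' v)
    (e : HeightOneSpectrum (𝓞 K) → ℤ_[3]) (he : ∀ v ∈ T, e v ≠ 0 ∧ (e v).valuation = c v)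
    {L L' : UnrSeries 3} {m m' : ℕ}
    (hm : (∀ i < m, ‖((PowerSeries.coeff i L : unrIntegers 3) : ℂ_[3])‖ < 1) ∧
      ‖((PowerSeries.coeff m L : unrIntegers 3) : ℂ_[3])‖ = 1)
    (hm' : (∀ i < m', ‖((PowerSeries.coeff i L' : unrIntegers 3) : ℂ_[3])‖ < 1) ∧
      ‖((PowerSeries.coeff m' L' : unrIntegers 3) : ℂ_[3])‖ = 1)
    (hsum : m + ∑ v ∈ T, 3 ^ c v * s v = m' + ∑ v ∈ T, 3 ^ c v * s' v) :
    ∃ u : UnrSeries 3, IsUnit u ∧ ∀ i : ℕ, ‖((PowerSeries.coeff i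
        (L * PowerSeries.map (Halves.toUnr 3) (∏ v ∈ T, (Polynomial.aeval
            (PowerSeries.C ((Nat.card (IsLocalRing.ResidueField (v.adicCompletionIntegers K)) : ℤ_[3]).inv) *
              PowerSeries.binomialSeries ℤ_[3] (e v)) ((W.baseChange K).localPolynomialAt v) :
                IwasawaAlgebra 3)) -
          u * (L' * PowerSeries.map (Halves.toUnr 3) (∏ v ∈ T, (Polynomial.aeval
            (PowerSeries.C ((Nat.card (IsLocalRing.ResidueField (v.adicCompletionIntegers K)) : ℤ_[3]).inv) *
              PowerSeries.binomialSeries ℤ_[3] (e v)) ((W'.baseChange K).localPolynomialAt v) :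
                IwasawaAlgebra 3)))) :
        unrIntegers 3) : ℂ_[3])‖ < 1 := by
  haveI : Fact (Nat.Prime 3) := ⟨Nat.prime_three⟩
  -- `d_v · 3^{v(e_v)} = 3^{c_v} · s_v` place by place (as in `analyticIdentity_of_sigmaCongruence`)
  have hD : ∀ v ∈ T, ¬ (decomp v ≤ κ.kerSubgroup) := by
    intro v hv hle
    obtain ⟨⟨d₀, hd₀⟩, -⟩ := hdata v hv
    have h1 : κ (d₀ : absoluteGaloisGroup K) = 1 := (ZpExtension.mem_kerSubgroup).mp (hle d₀.2)
    rw [h1, toAdd_one] at hd₀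
    exact pow_ne_zero (c v) (by norm_num : (3 : ℤ_[3]) ≠ 0) hd₀.symm
  have hloc : ∀ v ∈ T,
      (eulerFactorModP (W.baseChange K) 3 v).rootMultiplicity
            (((Nat.card (IsLocalRing.ResidueField (v.adicCompletionIntegers K)) : ℕ) : ZMod 3)⁻¹) *
          3 ^ (e v).valuation = 3 ^ c v * s v ∧
        (eulerFactorModP (W'.baseChange K) 3 v).rootMultiplicity
            (((Nat.card (IsLocalRing.ResidueField (v.adicCompletionIntegers K)) : ℕ) : ZMod 3)⁻¹) *
          3 ^ (e v).valuation = 3 ^ c v * s' v := by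
    intro v hv
    obtain ⟨-, -, hs, hs'⟩ := hdata v hv
    rw [natCard_pTorsion_subgroupH1_kerD_eq_pow_rootMultiplicity (W.baseChange K) v κ (hT v hv) (hD v hv)]
      at hs
    rw [natCard_pTorsion_subgroupH1_kerD_eq_pow_rootMultiplicity (W'.baseChange K) v κ (hT v hv) (hD v hv)]
      at hs'
    have h3 : Function.Injective (fun k : ℕ ↦ 3 ^ k) := Nat.pow_right_injective (by norm_num)
    have hsd := h3 hs
    have hsd' := h3 hs'
    rw [hsd, hsd', (he v hv).2]
    exact ⟨mul_comm _ _, mul_comm _ _⟩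
  refine exists_isUnit_sigmaCongruence_of_normProfile (W.baseChange K) (W'.baseChange K) T hT e
    (fun v hv ↦ (he v hv).1) hm hm' ?_
  rw [Finset.sum_congr rfl fun v hv ↦ (hloc v hv).1, Finset.sum_congr rfl fun v hv ↦ (hloc v hv).2]
  exact hsum

end Summit.BirchSwinnertonDyer.BirchSwinnertonDyer.Theorems.UniversalToricDescentDefectTransport

end
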